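import Summits.QuantumFields.YangMills.Theorems.UnitScaleTiltProp7Kernel133DoorOfKinvRow
import Summits.QuantumFields.YangMills.Theorems.UnitScaleTiltProp7GreenPiBlockLettersEdition
import HarnessLib

/-!
# Route `UnitScaleTilt`, crux K1 «MinimiserStabilityRegPr» (stmt-QuantumFields-19200), EX face — K-STOREY × N6, FILE (H-KNIT):
# **THE EX ROW `h133` (the (3.133) kernel of `H_π = G_πQ_k†(Q_kG_πQ_k†)⁻¹`) FROM THE COARSE ENTRY ROW `hKinv`(Π) AND THE FIVE BLOCK-SUPPORTED LETTERS OF `G_π`** —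
# the H-DOOR ✓`Prop7Kernel133DoorOfKinvRow` fed N6 FILE D3 ✓`Prop7GreenPiBlockLettersEdition.hGblk_pi_of_blockLetters`; MEMBER and Idx∕FAMILY editions (+ the rate-lowering toolkit)

Cell `ym3-torus` (HUMAN RULING D-0037; rung R3 = SU(2) YM₃ on T³ — NOT d = 4, NOT infinite volume, NOT a mass gap, NOT Clay).  Width seat `ym3-torus-px10` (gen 14; FREE px; ★p1 g27
11:45:13Z «the `h133`(Π) MEMBER KNIT is yours» + CHAIR WORD №32 «next chair pen: the K-storey (Idx) edition of D2∕D3 in px10's `kernel133_family_…` `hGblk` family text»).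
THEOREMS ONLY (0 `def`, 0 `sorry`, default heartbeats); `--supports stmt-QuantumFields-19200 --as helper`; count-neutral.

THE ROW (EX display S47 ✓`Prop7StubEXOfChartPiecesTwS47` ll.183–193): `h133 := ‖flat115 (H1f … (a L i) (DeltaPiSlotP … (a L i)) U₀ (δ_y ⊗ Z)) b′‖ ≤ CH L·e^{−(δH L∕2)·tdist(B((bondEquiv)⁻¹b′)₋, ŷ)}·‖Z‖`
under `RegPr ρ U₀ → ρ ≤ αcap L → Lift →`.  THE TWO INPUT FAMILIES OF THE H-DOOR (✓`kernel133_family_of_kinvRow_of_greenBlockSup`): `hKinv`(Π) — the coarse entry row of `K⁻¹ = (Q_kG_πQ_k†)⁻¹`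
(⟸ ✓`Prop7KinvRowOfConjLetters` §3 from L-only {m₀, B_G, δ₃, window (R_L)}) — and `hGblk`(Π) — block-supported source ⟹ decayed `G_π`-values.  N6 FILE D3 supplies `hGblk`(Π) from FIVE
BLOCK-SUPPORTED LETTERS at a rate `δ₁ ≥ δ + ν`: (Gb) block VALUE row of `G₀ = GT … (DeltaEtaSlot …)` (px16 ✓`Prop7OneFormGreenSupBound` §3 ∕ (Gb)-K ∕ (Gb)-FAMILY), (Db) block DIVERGENCE row
of `G₀` (px21 (dκ) ✓`Prop7OneFormGreenBlockDivergence` ∕ (dκ)-K ∕ (Db)-FAMILY), (c1b)(c2b)(c3b) block editions of the scalar storey's `G′ᴾR_S`, `DG′ᴾR_S`, `R_SG′ᴾ` (px5 W4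
✓`hc1b_of_letters`∕`hc2b_of_letters`∕`hc3b_of_letters`), plus ONE window row `hwin` and `PosOnto` at `Δ^η` and at `Δ_πᴾ`.

WHAT IS PROVED (ns `Summit.QuantumFields.YangMills.Theorems.Prop7Kernel133OfPiBlockLetters`).
§0 RATE TOOLKIT (so suppliers at different rates dock by one term): ★`blockLetter_mono_rate` (abstract reader `Φ`: a block-supported letter at rate `δ₁` is one at every `δ₁′ ≤ δ₁`),
★`coarseRow_mono_rate` (the `hKinv` row at rate `μ` is one at every `δ ≤ μ`).
§1 MEMBER, generic member `F n K`: ★★★`kernelH_of_kinvRow_of_piBlockLetters` (the coarse→fine kernel of `HT` at the Π-slot) and ★★★`kernel133_of_kinvRow_of_piBlockLetters` (the `h133`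
MEMBER TEXT, `flat115 ∘ H1f` dressing) ⟸ {`RegPr ε₀` + the two ε-windows, `0 ≤ a`, `PosOnto`(Δ^η), `PosOnto`(Δ_πᴾ), `hKinv`(Π) at `(C_K, δ)`, the five block letters at `δ₁` with
constants `BV BD C₁ C₂ C₃`, `0 < ν`, `δ + ν ≤ δ₁`, D3's window `hwin`} — constant = the H-door's with `C_G := 2(BV·V + BD·V)`, `V := (2(1+1∕ν))³`, rate `δ∕2`.  ONE TERM each:
✓`kernelH_of_kinvRow_of_greenBlockSup` ∕ ✓`kernel133_of_kinvRow_of_greenBlockSup` fed `(hGblk_pi_of_blockLetters …).1`.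
§2 FAMILY (Idx edition, the chair's «K-storey edition of D3»): ★★★`hGblk_pi_family_of_blockLetters` — for a cap `α` (windows of record), L-only weights `c₀ cB`, member couplings
`0 ≤ a L i`, ANY thread `Λ L i U₀` (S47: Lift), the classes `PosOnto`(Δ^η)∕`PosOnto`(Δ_πᴾ) displayed under the thread, the FIVE block-letter FAMILIES with L-only constants
`BV BD C₁ C₂ C₃ : ℕ → ℝ` at an L-only rate `δ₁ L`, L-only `ν L > 0`, `δ L + ν L ≤ δ₁ L`, and ONE L-only window row `hwin L` (D3's at `α := α L`): the H-DOOR §4's `hGblk` FAMILY TEXT at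
the Π-slot VERBATIM with `CG L := 2(BV L·V L + BD L·V L)` and rate `δ L`; ★★★`kernel133_family_of_kinvRow_of_piBlockLetters` — the S47 ROW TEXT of `h133` (✓`kernel133_family_…`'s
conclusion, byte-identical up to `CG L :=` the above) ⟸ {`hKinv`(Π) family (the H-door's binder verbatim), §2's inputs}; so `CH L = 1920·e^{δ L+1}·CK L·2(BV L·V L + BD L·V L)·(2(1+2∕δ L))³`,
`δH := δ`.  The S48 `h133` ∃-package is then ONE `obtain`-chain over the suppliers' ∃-families (caps by `min`, rates by §0).
HYP-SAT (★★OWNER №42).  Every displayed letter is a row of record with a named supplier (K2-KNIT §3; (Gb)∕(Db)∕(c·b) families; (γ)∕S45 for the two `PosOnto`); no conclusion-shaped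
letter (the conclusion is the kernel of a THREE-factor composite after a five-letter bootstrap); windows are inequalities among L-only letters, inhabited for small `α L`.
HONEST SCOPE.  Knits over landed doors; no estimate of print is proved here; nothing of the five letters' suppliers, `hKinv`'s inputs (m₀, δ₃), `norm_G`, the other EX rows, EX or
the crux is proved; the Yang–Mills mass gap is NOT proved.

References: T. Bałaban, CMP **99** (1985) 389–434 [Balaban1985BackgroundPropagators] ((3.42) p.397, (3.46)–(3.49) pp.398–399, (3.126) p.420, (3.132)–(3.133) p.422, Thm 3.12 p.423);
CMP **102** (1985) 277–309 [Balaban1985Variational] ((45)–(46) p.285, (103) p.293, (115) p.294, (133) p.298).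
-/

set_option autoImplicit false

noncomputable section

open scoped BigOperators Matrix.Norms.L2Operator InnerProductSpace ComplexConjugate

namespace Summit.QuantumFields.YangMills.Theorems.Prop7Kernel133OfPiBlockLetters

open Literature.MathematicalPhysics.QuantumFieldTheory.Balaban1983to89
open Literature.MathematicalPhysics.QuantumFieldTheory.Balaban1983to89.T3ContinuumYM3Torus
open Literature.MathematicalPhysics.QuantumFieldTheory.Balaban1983to89.T3Thm1Carrier
open T3PrintedRegularMinimiser (RegPr)
open T3PrintedMinimiserExistence (regPr_mono)
open T3PrintedRegularOrbits (sites_eq)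
open T3LevelShift (siteShift)
open B9SectCLatticeCarrier (Bond)
open B9Eq311L2Pairing (WL2)
open B11Eq103H1Complex (BondL2K)
open B11Eq90V0primeCurrent (flat115)
open B5Eq118OneStroke (iterBlockOf)
open Summit.QuantumFields.YangMills.Theorems.Prop7SectET3Transport (periodsT3 bondEquiv)
open Summit.QuantumFields.YangMills.Theorems.Prop7SectET3HilbertLetters (W₂ toL2 toL2S toL2B DL2 DstarL2)
open Summit.QuantumFields.YangMills.Theorems.Prop7SectET3GaugeProjector (RS)
open Summit.QuantumFields.YangMills.Theorems.Prop7SectET3WilsonHessian (DeltaEtaSlot)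
open Summit.QuantumFields.YangMills.Theorems.Prop7SectET3CurvedPropagators (GT KinvT HT H1f PosOnto)
open Summit.QuantumFields.YangMills.Theorems.Prop7SectET3DeltaPiPInv (GprimeP DeltaPiSlotP)
open Summit.QuantumFields.YangMills.Theorems.Prop7Kernel133DoorOfKinvRow (kernelH_of_kinvRow_of_greenBlockSup kernel133_of_kinvRow_of_greenBlockSup
  kernel133_family_of_kinvRow_of_greenBlockSup)
open Summit.QuantumFields.YangMills.Theorems.Prop7GreenPiBlockLettersEdition (hGblk_pi_of_blockLetters)

/-! ## §0 ★ The rate toolkit -/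

section Rates

variable {F : T3Family} {n K : ℕ}

/-- ★ **A BLOCK-SUPPORTED LETTER AT RATE `δ₁` IS ONE AT EVERY RATE `δ₁′ ≤ δ₁`** (abstract reader `Φ`, block map `loc`; `0 ≤ C`).
[cite: Balaban1985BackgroundPropagators, (3.47)–(3.49) pp.398–399] -/
theorem blockLetter_mono_rate {ι κ : Type*} (blk : ι → Site (F.P K) (K - n)) (loc : κ → Site (F.P K) (K - n))
    (Φ : (ι → Matrix (Fin 2) (Fin 2) ℂ) → κ → Matrix (Fin 2) (Fin 2) ℂ) {C δ₁ δ₁' : ℝ} (hC : 0 ≤ C) (hle : δ₁' ≤ δ₁)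
    (hblk : ∀ (X : ι → Matrix (Fin 2) (Fin 2) ℂ) (z : Site (F.P K) (K - n)), (∀ i, X i ≠ 0 → blk i = z) → ∀ s : ℝ, 0 ≤ s → (∀ i, ‖X i‖ ≤ s) →
      ∀ k, ‖Φ X k‖ ≤ s * C * Real.exp (-(δ₁ * (Site.tdist (loc k) z : ℝ)))) :
    ∀ (X : ι → Matrix (Fin 2) (Fin 2) ℂ) (z : Site (F.P K) (K - n)), (∀ i, X i ≠ 0 → blk i = z) → ∀ s : ℝ, 0 ≤ s → (∀ i, ‖X i‖ ≤ s) →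
      ∀ k, ‖Φ X k‖ ≤ s * C * Real.exp (-(δ₁' * (Site.tdist (loc k) z : ℝ))) := by
  intro X z hXz s hs hX k
  refine (hblk X z hXz s hs hX k).trans (mul_le_mul_of_nonneg_left ?_ (mul_nonneg hs hC))
  rw [Real.exp_le_exp]
  have : (0 : ℝ) ≤ (Site.tdist (loc k) z : ℝ) := Nat.cast_nonneg _
  nlinarith

/-- ★ **THE COARSE ROW AT RATE `μ` IS ONE AT EVERY RATE `δ ≤ μ`** (the `hKinv` letter shape; `0 ≤ C_K`).
[cite: Balaban1985BackgroundPropagators, (3.132) p.422] -/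
theorem coarseRow_mono_rate (h : n ≤ K) (cB : ℝ) (T : WL2 ℂ (fun _ : PBond (F.P n) 0 => cB) W₂ →ₗ[ℂ] WL2 ℂ (fun _ : PBond (F.P n) 0 => cB) W₂)
    {CK μ δ : ℝ} (hCK : 0 ≤ CK) (hle : δ ≤ μ)
    (hrow : ∀ (y : PBond (F.P n) 0) (Z : Matrix (Fin 2) (Fin 2) ℂ) (y' : PBond (F.P n) 0),
      ‖(toL2B F n cB).symm (T (toL2B F n cB (Pi.single y Z))) y'‖
        ≤ CK * Real.exp (-(μ * (Site.tdist (P := F.P K) (siteShift (sites_eq F n K h) y'.src) (siteShift (sites_eq F n K h) y.src) : ℝ))) * ‖Z‖) :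
    ∀ (y : PBond (F.P n) 0) (Z : Matrix (Fin 2) (Fin 2) ℂ) (y' : PBond (F.P n) 0),
      ‖(toL2B F n cB).symm (T (toL2B F n cB (Pi.single y Z))) y'‖
        ≤ CK * Real.exp (-(δ * (Site.tdist (P := F.P K) (siteShift (sites_eq F n K h) y'.src) (siteShift (sites_eq F n K h) y.src) : ℝ))) * ‖Z‖ := by
  intro y Z y'
  refine (hrow y Z y').trans (mul_le_mul_of_nonneg_right (mul_le_mul_of_nonneg_left ?_ hCK) (norm_nonneg _))
  rw [Real.exp_le_exp]
  have : (0 : ℝ) ≤ (Site.tdist (P := F.P K) (siteShift (sites_eq F n K h) y'.src) (siteShift (sites_eq F n K h) y.src) : ℝ) := Nat.cast_nonneg _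
  nlinarith

end Rates

/-! ## §1 ★★★ The member: `h133` from `hKinv`(Π) and the five block letters -/

section Member

variable (F : T3Family) {n K : ℕ} (h : n ≤ K) (c₀ cB : ℝ) [Fact (0 < c₀)] [Fact (0 < cB)]

/-- ★★★ **THE KERNEL OF `H_π = G_π ∘ Q_k† ∘ K⁻¹` (coarse → fine) AT THE Π-SLOT FROM `hKinv`(Π) AND THE FIVE BLOCK LETTERS**, MEMBER: on `RegPr F n K ε₀ U₀` with the two ε-windows,
`0 ≤ a`, the classes `PosOnto`(Δ^η) and `PosOnto`(Δ_πᴾ), the coarse entry row `hKinv` (C_K, δ), the five block-supported letters (Gb)(Db)(c1b)(c2b)(c3b) at rate `δ₁ ≥ δ + ν` and D3's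
window: `‖toL2⁻¹(HT …(toL2B(δ_y ⊗ Z)))(bd)‖ ≤ C_G·((2·5·(cB∕c₀)ℓ⁻³e^{δ+1})·C_K·192)·(2(1+2∕δ))³·e^{−(δ∕2)·tdist(B bd₋, ŷ)}·‖Z‖`, `C_G = 2(BV·V + BD·V)`, `V = (2(1+1∕ν))³`.
[cite: Balaban1985BackgroundPropagators, (3.42) p.397, (3.126) p.420, (3.132)–(3.133) p.422, Thm 3.12 p.423; Balaban1985Variational, (45)–(46) p.285] -/
theorem kernelH_of_kinvRow_of_piBlockLetters {ε₀ : ℝ} (hε₀ : 0 < ε₀) (hε : 10 ^ 10 * (F.L : ℝ) ^ 6 * ε₀ ≤ 1) (hε12 : 10 ^ 12 * (F.L : ℝ) ^ 3 * ε₀ ≤ 1)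
    (U₀ : GaugeField (F.P K) 0 (Matrix.specialUnitaryGroup (Fin 2) ℂ)) (hreg : RegPr F n K ε₀ U₀) {a : ℝ} (ha : 0 ≤ a)
    (hp₀ : PosOnto F n K h c₀ cB a (DeltaEtaSlot F n K c₀) U₀) (hpπ : PosOnto F n K h c₀ cB a (DeltaPiSlotP F n K h c₀ cB a) U₀)
    {CK δ δ₁ ν : ℝ} (hCK : 0 ≤ CK) (hδ : 0 < δ) (hν : 0 < ν) (hδ₁ : δ + ν ≤ δ₁)
    (hKinv : ∀ (y : PBond (F.P n) 0) (Z : Matrix (Fin 2) (Fin 2) ℂ) (y' : PBond (F.P n) 0),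
      ‖(toL2B F n cB).symm (KinvT F n K h c₀ cB a (DeltaPiSlotP F n K h c₀ cB a) U₀ (toL2B F n cB (Pi.single y Z))) y'‖
        ≤ CK * Real.exp (-(δ * (Site.tdist (P := F.P K) (siteShift (sites_eq F n K h) y'.src) (siteShift (sites_eq F n K h) y.src) : ℝ))) * ‖Z‖)
    {BV BD C₁ C₂ C₃ : ℝ} (hBV : 0 ≤ BV) (hBD : 0 ≤ BD) (hC₁ : 0 ≤ C₁) (hC₂ : 0 ≤ C₂) (hC₃ : 0 ≤ C₃)
    (hGb : ∀ (X : PBond (F.P K) 0 → Matrix (Fin 2) (Fin 2) ℂ) (z : Site (F.P K) (K - n)), (∀ b, X b ≠ 0 → iterBlockOf (K - n) b.src = z) →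
      ∀ s : ℝ, 0 ≤ s → (∀ b, ‖X b‖ ≤ s) →
        ∀ bd : PBond (F.P K) 0, ‖(toL2 F K c₀).symm (GT F n K h c₀ cB a (DeltaEtaSlot F n K c₀) U₀ (toL2 F K c₀ X)) bd‖
          ≤ s * BV * Real.exp (-(δ₁ * (Site.tdist (P := F.P K) (iterBlockOf (K - n) bd.src) z : ℝ))))
    (hDb : ∀ (X : PBond (F.P K) 0 → Matrix (Fin 2) (Fin 2) ℂ) (z : Site (F.P K) (K - n)), (∀ b, X b ≠ 0 → iterBlockOf (K - n) b.src = z) →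
      ∀ s : ℝ, 0 ≤ s → (∀ b, ‖X b‖ ≤ s) →
        ∀ x : Site (F.P K) 0, ‖(toL2S F K c₀).symm (DstarL2 F n K c₀ U₀ (GT F n K h c₀ cB a (DeltaEtaSlot F n K c₀) U₀ (toL2 F K c₀ X))) x‖
          ≤ s * BD * Real.exp (-(δ₁ * (Site.tdist (P := F.P K) (iterBlockOf (K - n) x) z : ℝ))))
    (hc1b : ∀ (v : Site (F.P K) 0 → Matrix (Fin 2) (Fin 2) ℂ) (z : Site (F.P K) (K - n)), (∀ y, v y ≠ 0 → iterBlockOf (K - n) y = z) →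
      ∀ m : ℝ, 0 ≤ m → (∀ y, ‖v y‖ ≤ m) →
        ∀ y : Site (F.P K) 0, ‖(toL2S F K c₀).symm (GprimeP F n K h c₀ cB a U₀ (RS F n K h c₀ cB U₀ (toL2S F K c₀ v))) y‖
          ≤ m * C₁ * Real.exp (-(δ₁ * (Site.tdist (P := F.P K) (iterBlockOf (K - n) y) z : ℝ))))
    (hc2b : ∀ (v : Site (F.P K) 0 → Matrix (Fin 2) (Fin 2) ℂ) (z : Site (F.P K) (K - n)), (∀ y, v y ≠ 0 → iterBlockOf (K - n) y = z) →
      ∀ m : ℝ, 0 ≤ m → (∀ y, ‖v y‖ ≤ m) →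
        ∀ b : PBond (F.P K) 0, ‖(toL2 F K c₀).symm (DL2 F n K c₀ U₀ (GprimeP F n K h c₀ cB a U₀ (RS F n K h c₀ cB U₀ (toL2S F K c₀ v)))) b‖
          ≤ m * C₂ * Real.exp (-(δ₁ * (Site.tdist (P := F.P K) (iterBlockOf (K - n) b.src) z : ℝ))))
    (hc3b : ∀ (v : Site (F.P K) 0 → Matrix (Fin 2) (Fin 2) ℂ) (z : Site (F.P K) (K - n)), (∀ y, v y ≠ 0 → iterBlockOf (K - n) y = z) →
      ∀ m : ℝ, 0 ≤ m → (∀ y, ‖v y‖ ≤ m) →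
        ∀ y : Site (F.P K) 0, ‖(toL2S F K c₀).symm (RS F n K h c₀ cB U₀ (GprimeP F n K h c₀ cB a U₀ (toL2S F K c₀ v))) y‖
          ≤ m * C₃ * Real.exp (-(δ₁ * (Site.tdist (P := F.P K) (iterBlockOf (K - n) y) z : ℝ))))
    (hwin : 2 * (1 + Real.exp (4 * δ)) * (ε₀ * (C₁ * (2 * (1 + 1 / ν)) ^ 3) * (BV * (2 * (1 + 1 / ν)) ^ 3 + BD * (2 * (1 + 1 / ν)) ^ 3)
      + 3 * ε₀ * (C₃ * (2 * (1 + 1 / ν)) ^ 3) * (1 + C₂ * (2 * (1 + 1 / ν)) ^ 3)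
        * (1 + C₂ * (2 * (1 + 1 / ν)) ^ 3 + 2 * (1 + Real.exp (4 * δ)) * ε₀ * (C₁ * (2 * (1 + 1 / ν)) ^ 3) * (BV * (2 * (1 + 1 / ν)) ^ 3 + BD * (2 * (1 + 1 / ν)) ^ 3))) ≤ 1 / 2)
    (y : PBond (F.P n) 0) (Z : Matrix (Fin 2) (Fin 2) ℂ) (bd : PBond (F.P K) 0) :
    ‖(toL2 F K c₀).symm (HT F n K h c₀ cB a (DeltaPiSlotP F n K h c₀ cB a) U₀ (toL2B F n cB (Pi.single y Z))) bd‖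
      ≤ (2 * (BV * (2 * (1 + 1 / ν)) ^ 3 + BD * (2 * (1 + 1 / ν)) ^ 3))
          * ((2 * 5 * (cB / c₀) * ((F.L : ℝ) ^ (K - n))⁻¹ ^ 3 * Real.exp (δ + 1)) * CK * (3 * (2 * (1 + 1 / 1)) ^ 3)) * (2 * (1 + 1 / (δ / 2))) ^ 3
          * Real.exp (-(δ / 2 * (Site.tdist (P := F.P K) (iterBlockOf (K - n) bd.src) (siteShift (sites_eq F n K h) y.src) : ℝ))) * ‖Z‖ :=
  have hV : 0 ≤ (2 * (1 + 1 / ν)) ^ 3 := by positivity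
  kernelH_of_kinvRow_of_greenBlockSup F h c₀ cB hε₀ hε hε12 U₀ hreg a (DeltaPiSlotP F n K h c₀ cB a) hpπ hCK (by positivity) hδ hKinv
    (hGblk_pi_of_blockLetters hδ.le hν hδ₁ U₀ hreg ha hp₀ hpπ hBV hBD hC₁ hC₂ hC₃ hGb hDb hc1b hc2b hc3b hwin).1 y Z bd

/-- ★★★ **KNIT «KERNEL-133 FROM `hKinv`(Π) AND THE FIVE BLOCK LETTERS», MEMBER**: the `h133` member text (the `flat115 ∘ H1f ∘ (bondEquiv)⁻¹` dressing of the above) —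
`‖flat115 (H1f … a (DeltaPiSlotP … a) U₀ (δ_y ⊗ Z)) b′‖ ≤ C_G·((2·5·(cB∕c₀)ℓ⁻³e^{δ+1})·C_K·192)·(2(1+2∕δ))³·e^{−(δ∕2)·tdist(B((bondEquiv)⁻¹b′)₋, ŷ)}·‖Z‖`, `C_G = 2(BV·V + BD·V)`.
[cite: Balaban1985BackgroundPropagators, (3.133) p.422, Thm 3.12 p.423, (3.42) p.397; Balaban1985Variational, (45)–(46) p.285, (103) p.293, (133) p.298] -/
theorem kernel133_of_kinvRow_of_piBlockLetters [Fact (0 < (F.L : ℝ))] [Fact (0 < ((F.L : ℝ)⁻¹) ^ (K - n))]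
    {ε₀ : ℝ} (hε₀ : 0 < ε₀) (hε : 10 ^ 10 * (F.L : ℝ) ^ 6 * ε₀ ≤ 1) (hε12 : 10 ^ 12 * (F.L : ℝ) ^ 3 * ε₀ ≤ 1)
    (U₀ : GaugeField (F.P K) 0 (Matrix.specialUnitaryGroup (Fin 2) ℂ)) (hreg : RegPr F n K ε₀ U₀) {a : ℝ} (ha : 0 ≤ a)
    (hp₀ : PosOnto F n K h c₀ cB a (DeltaEtaSlot F n K c₀) U₀) (hpπ : PosOnto F n K h c₀ cB a (DeltaPiSlotP F n K h c₀ cB a) U₀)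
    {CK δ δ₁ ν : ℝ} (hCK : 0 ≤ CK) (hδ : 0 < δ) (hν : 0 < ν) (hδ₁ : δ + ν ≤ δ₁)
    (hKinv : ∀ (y : PBond (F.P n) 0) (Z : Matrix (Fin 2) (Fin 2) ℂ) (y' : PBond (F.P n) 0),
      ‖(toL2B F n cB).symm (KinvT F n K h c₀ cB a (DeltaPiSlotP F n K h c₀ cB a) U₀ (toL2B F n cB (Pi.single y Z))) y'‖
        ≤ CK * Real.exp (-(δ * (Site.tdist (P := F.P K) (siteShift (sites_eq F n K h) y'.src) (siteShift (sites_eq F n K h) y.src) : ℝ))) * ‖Z‖)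
    {BV BD C₁ C₂ C₃ : ℝ} (hBV : 0 ≤ BV) (hBD : 0 ≤ BD) (hC₁ : 0 ≤ C₁) (hC₂ : 0 ≤ C₂) (hC₃ : 0 ≤ C₃)
    (hGb : ∀ (X : PBond (F.P K) 0 → Matrix (Fin 2) (Fin 2) ℂ) (z : Site (F.P K) (K - n)), (∀ b, X b ≠ 0 → iterBlockOf (K - n) b.src = z) →
      ∀ s : ℝ, 0 ≤ s → (∀ b, ‖X b‖ ≤ s) →
        ∀ bd : PBond (F.P K) 0, ‖(toL2 F K c₀).symm (GT F n K h c₀ cB a (DeltaEtaSlot F n K c₀) U₀ (toL2 F K c₀ X)) bd‖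
          ≤ s * BV * Real.exp (-(δ₁ * (Site.tdist (P := F.P K) (iterBlockOf (K - n) bd.src) z : ℝ))))
    (hDb : ∀ (X : PBond (F.P K) 0 → Matrix (Fin 2) (Fin 2) ℂ) (z : Site (F.P K) (K - n)), (∀ b, X b ≠ 0 → iterBlockOf (K - n) b.src = z) →
      ∀ s : ℝ, 0 ≤ s → (∀ b, ‖X b‖ ≤ s) →
        ∀ x : Site (F.P K) 0, ‖(toL2S F K c₀).symm (DstarL2 F n K c₀ U₀ (GT F n K h c₀ cB a (DeltaEtaSlot F n K c₀) U₀ (toL2 F K c₀ X))) x‖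
          ≤ s * BD * Real.exp (-(δ₁ * (Site.tdist (P := F.P K) (iterBlockOf (K - n) x) z : ℝ))))
    (hc1b : ∀ (v : Site (F.P K) 0 → Matrix (Fin 2) (Fin 2) ℂ) (z : Site (F.P K) (K - n)), (∀ y, v y ≠ 0 → iterBlockOf (K - n) y = z) →
      ∀ m : ℝ, 0 ≤ m → (∀ y, ‖v y‖ ≤ m) →
        ∀ y : Site (F.P K) 0, ‖(toL2S F K c₀).symm (GprimeP F n K h c₀ cB a U₀ (RS F n K h c₀ cB U₀ (toL2S F K c₀ v))) y‖
          ≤ m * C₁ * Real.exp (-(δ₁ * (Site.tdist (P := F.P K) (iterBlockOf (K - n) y) z : ℝ))))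
    (hc2b : ∀ (v : Site (F.P K) 0 → Matrix (Fin 2) (Fin 2) ℂ) (z : Site (F.P K) (K - n)), (∀ y, v y ≠ 0 → iterBlockOf (K - n) y = z) →
      ∀ m : ℝ, 0 ≤ m → (∀ y, ‖v y‖ ≤ m) →
        ∀ b : PBond (F.P K) 0, ‖(toL2 F K c₀).symm (DL2 F n K c₀ U₀ (GprimeP F n K h c₀ cB a U₀ (RS F n K h c₀ cB U₀ (toL2S F K c₀ v)))) b‖
          ≤ m * C₂ * Real.exp (-(δ₁ * (Site.tdist (P := F.P K) (iterBlockOf (K - n) b.src) z : ℝ))))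
    (hc3b : ∀ (v : Site (F.P K) 0 → Matrix (Fin 2) (Fin 2) ℂ) (z : Site (F.P K) (K - n)), (∀ y, v y ≠ 0 → iterBlockOf (K - n) y = z) →
      ∀ m : ℝ, 0 ≤ m → (∀ y, ‖v y‖ ≤ m) →
        ∀ y : Site (F.P K) 0, ‖(toL2S F K c₀).symm (RS F n K h c₀ cB U₀ (GprimeP F n K h c₀ cB a U₀ (toL2S F K c₀ v))) y‖
          ≤ m * C₃ * Real.exp (-(δ₁ * (Site.tdist (P := F.P K) (iterBlockOf (K - n) y) z : ℝ))))
    (hwin : 2 * (1 + Real.exp (4 * δ)) * (ε₀ * (C₁ * (2 * (1 + 1 / ν)) ^ 3) * (BV * (2 * (1 + 1 / ν)) ^ 3 + BD * (2 * (1 + 1 / ν)) ^ 3)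
      + 3 * ε₀ * (C₃ * (2 * (1 + 1 / ν)) ^ 3) * (1 + C₂ * (2 * (1 + 1 / ν)) ^ 3)
        * (1 + C₂ * (2 * (1 + 1 / ν)) ^ 3 + 2 * (1 + Real.exp (4 * δ)) * ε₀ * (C₁ * (2 * (1 + 1 / ν)) ^ 3) * (BV * (2 * (1 + 1 / ν)) ^ 3 + BD * (2 * (1 + 1 / ν)) ^ 3))) ≤ 1 / 2)
    (y : PBond (F.P n) 0) (Z : Matrix (Fin 2) (Fin 2) ℂ) (b' : Bond 3 (periodsT3 F K)) :
    ‖flat115 (H1f F n K h c₀ cB a (DeltaPiSlotP F n K h c₀ cB a) U₀ (Pi.single y Z)) b'‖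
      ≤ (2 * (BV * (2 * (1 + 1 / ν)) ^ 3 + BD * (2 * (1 + 1 / ν)) ^ 3))
          * ((2 * 5 * (cB / c₀) * ((F.L : ℝ) ^ (K - n))⁻¹ ^ 3 * Real.exp (δ + 1)) * CK * (3 * (2 * (1 + 1 / 1)) ^ 3)) * (2 * (1 + 1 / (δ / 2))) ^ 3
          * Real.exp (-(δ / 2 * (Site.tdist (P := F.P K) (iterBlockOf (K - n) ((bondEquiv F K).symm b').src) (siteShift (sites_eq F n K h) y.src) : ℝ))) * ‖Z‖ :=
  have hV : 0 ≤ (2 * (1 + 1 / ν)) ^ 3 := by positivity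
  kernel133_of_kinvRow_of_greenBlockSup F h c₀ cB hε₀ hε hε12 U₀ hreg a (DeltaPiSlotP F n K h c₀ cB a) hpπ hCK (by positivity) hδ hKinv
    (hGblk_pi_of_blockLetters hδ.le hν hδ₁ U₀ hreg ha hp₀ hpπ hBV hBD hC₁ hC₂ hC₃ hGb hDb hc1b hc2b hc3b hwin).1 y Z b'

end Member

/-! ## §2 ★★★ The Idx ∕ family editions: the `hGblk`(Π) family text, and the S47 `h133` row text -/

section Family

/-- ★★★ **THE `hGblk`(Π) FAMILY TEXT OF THE H-DOOR FROM FIVE BLOCK-LETTER FAMILIES** (the K-storey ∕ Idx edition of N6 FILE D3).  Cap `α` with the two windows of record; L-only weights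
`c₀ cB`; member couplings `0 ≤ a L i`; ANY thread `Λ L i U₀` (S47: Lift); the classes `PosOnto`(Δ^η) and `PosOnto`(Δ_πᴾ) displayed under the thread; the five block-supported letters
(Gb)(Db)(c1b)(c2b)(c3b) as FAMILIES with L-only constants `BV BD C₁ C₂ C₃` at an L-only rate `δ₁ L`; `0 ≤ δ L`, `0 < ν L`, `δ L + ν L ≤ δ₁ L`; ONE L-only window row (D3's at `α := α L`).
CONCLUSION: ✓`kernel133_family_of_kinvRow_of_greenBlockSup`'s `hGblk` binder VERBATIM with `CG L := 2(BV L·(2(1+1∕ν L))³ + BD L·(2(1+1∕ν L))³)` at rate `δ L`.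
[cite: Balaban1985BackgroundPropagators, Thm 3.12 p.423, (3.42) p.397, (3.47)–(3.49) pp.398–399] -/
theorem hGblk_pi_family_of_blockLetters
    (α : ℕ → ℝ) (c₀ cB : ℕ → ℝ) [hc₀ : ∀ L : ℕ, Fact (0 < c₀ L)] [hcB : ∀ L : ℕ, Fact (0 < cB L)] (a : ∀ L : ℕ, Idx L → ℝ) (ha : ∀ (L : ℕ) (i : Idx L), 0 ≤ a L i)
    (Λ : ∀ (L : ℕ) (i : Idx L), GaugeField (i.1.1.P i.1.2.2) 0 (Matrix.specialUnitaryGroup (Fin 2) ℂ) → Prop)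
    (hposη : ∀ (L : ℕ), 1 < L → ∀ (i : Idx L) (U₀ : GaugeField (i.1.1.P i.1.2.2) 0 (Matrix.specialUnitaryGroup (Fin 2) ℂ)), ∀ ρ : ℝ, RegPr i.1.1 i.1.2.1 i.1.2.2 ρ U₀ → ρ ≤ α L →
      Λ L i U₀ → PosOnto i.1.1 i.1.2.1 i.1.2.2 i.2.2.le (c₀ L) (cB L) (a L i) (DeltaEtaSlot i.1.1 i.1.2.1 i.1.2.2 (c₀ L)) U₀)
    (hpos : ∀ (L : ℕ), 1 < L → ∀ (i : Idx L) (U₀ : GaugeField (i.1.1.P i.1.2.2) 0 (Matrix.specialUnitaryGroup (Fin 2) ℂ)), ∀ ρ : ℝ, RegPr i.1.1 i.1.2.1 i.1.2.2 ρ U₀ → ρ ≤ α L →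
      Λ L i U₀ → PosOnto i.1.1 i.1.2.1 i.1.2.2 i.2.2.le (c₀ L) (cB L) (a L i) (DeltaPiSlotP i.1.1 i.1.2.1 i.1.2.2 i.2.2.le (c₀ L) (cB L) (a L i)) U₀)
    (BV BD C₁ C₂ C₃ δ δ₁ ν : ℕ → ℝ) (hBV : ∀ L, 1 < L → 0 ≤ BV L) (hBD : ∀ L, 1 < L → 0 ≤ BD L) (hC₁ : ∀ L, 1 < L → 0 ≤ C₁ L) (hC₂ : ∀ L, 1 < L → 0 ≤ C₂ L)
    (hC₃ : ∀ L, 1 < L → 0 ≤ C₃ L) (hδ : ∀ L, 1 < L → 0 ≤ δ L) (hν : ∀ L, 1 < L → 0 < ν L) (hδ₁ : ∀ L, 1 < L → δ L + ν L ≤ δ₁ L)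
    (hGb : ∀ (L : ℕ), 1 < L → ∀ (i : Idx L) (U₀ : GaugeField (i.1.1.P i.1.2.2) 0 (Matrix.specialUnitaryGroup (Fin 2) ℂ)), ∀ ρ : ℝ, RegPr i.1.1 i.1.2.1 i.1.2.2 ρ U₀ → ρ ≤ α L →
      Λ L i U₀ → ∀ (X : PBond (i.1.1.P i.1.2.2) 0 → Matrix (Fin 2) (Fin 2) ℂ) (z : Site (i.1.1.P i.1.2.2) (i.1.2.2 - i.1.2.1)),
        (∀ b, X b ≠ 0 → iterBlockOf (i.1.2.2 - i.1.2.1) b.src = z) → ∀ s : ℝ, 0 ≤ s → (∀ b, ‖X b‖ ≤ s) →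
          ∀ bd : PBond (i.1.1.P i.1.2.2) 0, ‖(toL2 i.1.1 i.1.2.2 (c₀ L)).symm (GT i.1.1 i.1.2.1 i.1.2.2 i.2.2.le (c₀ L) (cB L) (a L i)
              (DeltaEtaSlot i.1.1 i.1.2.1 i.1.2.2 (c₀ L)) U₀ (toL2 i.1.1 i.1.2.2 (c₀ L) X)) bd‖
            ≤ s * BV L * Real.exp (-(δ₁ L * (Site.tdist (P := i.1.1.P i.1.2.2) (iterBlockOf (i.1.2.2 - i.1.2.1) bd.src) z : ℝ))))
    (hDb : ∀ (L : ℕ), 1 < L → ∀ (i : Idx L) (U₀ : GaugeField (i.1.1.P i.1.2.2) 0 (Matrix.specialUnitaryGroup (Fin 2) ℂ)), ∀ ρ : ℝ, RegPr i.1.1 i.1.2.1 i.1.2.2 ρ U₀ → ρ ≤ α L →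
      Λ L i U₀ → ∀ (X : PBond (i.1.1.P i.1.2.2) 0 → Matrix (Fin 2) (Fin 2) ℂ) (z : Site (i.1.1.P i.1.2.2) (i.1.2.2 - i.1.2.1)),
        (∀ b, X b ≠ 0 → iterBlockOf (i.1.2.2 - i.1.2.1) b.src = z) → ∀ s : ℝ, 0 ≤ s → (∀ b, ‖X b‖ ≤ s) →
          ∀ x : Site (i.1.1.P i.1.2.2) 0, ‖(toL2S i.1.1 i.1.2.2 (c₀ L)).symm (DstarL2 i.1.1 i.1.2.1 i.1.2.2 (c₀ L) U₀ (GT i.1.1 i.1.2.1 i.1.2.2 i.2.2.le (c₀ L) (cB L) (a L i)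
              (DeltaEtaSlot i.1.1 i.1.2.1 i.1.2.2 (c₀ L)) U₀ (toL2 i.1.1 i.1.2.2 (c₀ L) X))) x‖
            ≤ s * BD L * Real.exp (-(δ₁ L * (Site.tdist (P := i.1.1.P i.1.2.2) (iterBlockOf (i.1.2.2 - i.1.2.1) x) z : ℝ))))
    (hc1b : ∀ (L : ℕ), 1 < L → ∀ (i : Idx L) (U₀ : GaugeField (i.1.1.P i.1.2.2) 0 (Matrix.specialUnitaryGroup (Fin 2) ℂ)), ∀ ρ : ℝ, RegPr i.1.1 i.1.2.1 i.1.2.2 ρ U₀ → ρ ≤ α L →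
      Λ L i U₀ → ∀ (v : Site (i.1.1.P i.1.2.2) 0 → Matrix (Fin 2) (Fin 2) ℂ) (z : Site (i.1.1.P i.1.2.2) (i.1.2.2 - i.1.2.1)),
        (∀ y, v y ≠ 0 → iterBlockOf (i.1.2.2 - i.1.2.1) y = z) → ∀ m : ℝ, 0 ≤ m → (∀ y, ‖v y‖ ≤ m) →
          ∀ y : Site (i.1.1.P i.1.2.2) 0, ‖(toL2S i.1.1 i.1.2.2 (c₀ L)).symm (GprimeP i.1.1 i.1.2.1 i.1.2.2 i.2.2.le (c₀ L) (cB L) (a L i) U₀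
              (RS i.1.1 i.1.2.1 i.1.2.2 i.2.2.le (c₀ L) (cB L) U₀ (toL2S i.1.1 i.1.2.2 (c₀ L) v))) y‖
            ≤ m * C₁ L * Real.exp (-(δ₁ L * (Site.tdist (P := i.1.1.P i.1.2.2) (iterBlockOf (i.1.2.2 - i.1.2.1) y) z : ℝ))))
    (hc2b : ∀ (L : ℕ), 1 < L → ∀ (i : Idx L) (U₀ : GaugeField (i.1.1.P i.1.2.2) 0 (Matrix.specialUnitaryGroup (Fin 2) ℂ)), ∀ ρ : ℝ, RegPr i.1.1 i.1.2.1 i.1.2.2 ρ U₀ → ρ ≤ α L →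
      Λ L i U₀ → ∀ (v : Site (i.1.1.P i.1.2.2) 0 → Matrix (Fin 2) (Fin 2) ℂ) (z : Site (i.1.1.P i.1.2.2) (i.1.2.2 - i.1.2.1)),
        (∀ y, v y ≠ 0 → iterBlockOf (i.1.2.2 - i.1.2.1) y = z) → ∀ m : ℝ, 0 ≤ m → (∀ y, ‖v y‖ ≤ m) →
          ∀ b : PBond (i.1.1.P i.1.2.2) 0, ‖(toL2 i.1.1 i.1.2.2 (c₀ L)).symm (DL2 i.1.1 i.1.2.1 i.1.2.2 (c₀ L) U₀ (GprimeP i.1.1 i.1.2.1 i.1.2.2 i.2.2.le (c₀ L) (cB L) (a L i) U₀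
              (RS i.1.1 i.1.2.1 i.1.2.2 i.2.2.le (c₀ L) (cB L) U₀ (toL2S i.1.1 i.1.2.2 (c₀ L) v)))) b‖
            ≤ m * C₂ L * Real.exp (-(δ₁ L * (Site.tdist (P := i.1.1.P i.1.2.2) (iterBlockOf (i.1.2.2 - i.1.2.1) b.src) z : ℝ))))
    (hc3b : ∀ (L : ℕ), 1 < L → ∀ (i : Idx L) (U₀ : GaugeField (i.1.1.P i.1.2.2) 0 (Matrix.specialUnitaryGroup (Fin 2) ℂ)), ∀ ρ : ℝ, RegPr i.1.1 i.1.2.1 i.1.2.2 ρ U₀ → ρ ≤ α L →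
      Λ L i U₀ → ∀ (v : Site (i.1.1.P i.1.2.2) 0 → Matrix (Fin 2) (Fin 2) ℂ) (z : Site (i.1.1.P i.1.2.2) (i.1.2.2 - i.1.2.1)),
        (∀ y, v y ≠ 0 → iterBlockOf (i.1.2.2 - i.1.2.1) y = z) → ∀ m : ℝ, 0 ≤ m → (∀ y, ‖v y‖ ≤ m) →
          ∀ y : Site (i.1.1.P i.1.2.2) 0, ‖(toL2S i.1.1 i.1.2.2 (c₀ L)).symm (RS i.1.1 i.1.2.1 i.1.2.2 i.2.2.le (c₀ L) (cB L) U₀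
              (GprimeP i.1.1 i.1.2.1 i.1.2.2 i.2.2.le (c₀ L) (cB L) (a L i) U₀ (toL2S i.1.1 i.1.2.2 (c₀ L) v))) y‖
            ≤ m * C₃ L * Real.exp (-(δ₁ L * (Site.tdist (P := i.1.1.P i.1.2.2) (iterBlockOf (i.1.2.2 - i.1.2.1) y) z : ℝ))))
    (hwin : ∀ L, 1 < L → 2 * (1 + Real.exp (4 * δ L)) * (α L * (C₁ L * (2 * (1 + 1 / ν L)) ^ 3) * (BV L * (2 * (1 + 1 / ν L)) ^ 3 + BD L * (2 * (1 + 1 / ν L)) ^ 3)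
      + 3 * α L * (C₃ L * (2 * (1 + 1 / ν L)) ^ 3) * (1 + C₂ L * (2 * (1 + 1 / ν L)) ^ 3)
        * (1 + C₂ L * (2 * (1 + 1 / ν L)) ^ 3 + 2 * (1 + Real.exp (4 * δ L)) * α L * (C₁ L * (2 * (1 + 1 / ν L)) ^ 3)
          * (BV L * (2 * (1 + 1 / ν L)) ^ 3 + BD L * (2 * (1 + 1 / ν L)) ^ 3))) ≤ 1 / 2) :
    ∀ (L : ℕ), 1 < L → ∀ (i : Idx L) (U₀ : GaugeField (i.1.1.P i.1.2.2) 0 (Matrix.specialUnitaryGroup (Fin 2) ℂ)), ∀ ρ : ℝ, RegPr i.1.1 i.1.2.1 i.1.2.2 ρ U₀ → ρ ≤ α L →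
      Λ L i U₀ → ∀ (X : PBond (i.1.1.P i.1.2.2) 0 → Matrix (Fin 2) (Fin 2) ℂ) (z : Site (i.1.1.P i.1.2.2) (i.1.2.2 - i.1.2.1)),
        (∀ b, X b ≠ 0 → iterBlockOf (i.1.2.2 - i.1.2.1) b.src = z) → ∀ s : ℝ, 0 ≤ s → (∀ b, ‖X b‖ ≤ s) →
          ∀ bd : PBond (i.1.1.P i.1.2.2) 0, ‖(toL2 i.1.1 i.1.2.2 (c₀ L)).symm (GT i.1.1 i.1.2.1 i.1.2.2 i.2.2.le (c₀ L) (cB L) (a L i)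
              (DeltaPiSlotP i.1.1 i.1.2.1 i.1.2.2 i.2.2.le (c₀ L) (cB L) (a L i)) U₀ (toL2 i.1.1 i.1.2.2 (c₀ L) X)) bd‖
            ≤ s * (2 * (BV L * (2 * (1 + 1 / ν L)) ^ 3 + BD L * (2 * (1 + 1 / ν L)) ^ 3))
                * Real.exp (-(δ L * (Site.tdist (iterBlockOf (i.1.2.2 - i.1.2.1) bd.src) z : ℝ))) := by
  intro L hL i U₀ ρ hreg hρ hl
  have hregα : RegPr i.1.1 i.1.2.1 i.1.2.2 (α L) U₀ := regPr_mono (F := i.1.1) hρ hreg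
  exact (hGblk_pi_of_blockLetters (hδ L hL) (hν L hL) (hδ₁ L hL) U₀ hregα (ha L i) (hposη L hL i U₀ ρ hreg hρ hl) (hpos L hL i U₀ ρ hreg hρ hl)
    (hBV L hL) (hBD L hL) (hC₁ L hL) (hC₂ L hL) (hC₃ L hL) (hGb L hL i U₀ ρ hreg hρ hl) (hDb L hL i U₀ ρ hreg hρ hl) (hc1b L hL i U₀ ρ hreg hρ hl)
    (hc2b L hL i U₀ ρ hreg hρ hl) (hc3b L hL i U₀ ρ hreg hρ hl) (hwin L hL)).1

/-- ★★★ **KNIT «KERNEL-133», Idx EDITION — THE S47 ROW TEXT OF `h133` FROM THE `hKinv`(Π) FAMILY AND THE FIVE BLOCK-LETTER FAMILIES.**  Cap `α` with the windows of record; L-only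
weights; member couplings `0 ≤ a L i`; ANY thread `Λ` (S47: Lift); `PosOnto`(Δ^η)∕`PosOnto`(Δ_πᴾ) under the thread; `hKinv`(Π) at `CK L·((c₀ L∕cB L)·ℓ³)` and rate `δ L > 0` (the H-door's
binder verbatim); the five block-letter families at rate `δ₁ L ≥ δ L + ν L` with L-only `BV BD C₁ C₂ C₃`; the window row.  CONCLUSION: the S47 `h133` ROW TEXT under the same thread with
`CH L := 1920·e^{δ L+1}·CK L·(2(BV L·V L + BD L·V L))·(2(1+2∕δ L))³`, `V L = (2(1+1∕ν L))³`, `δH := δ` (NO `η`-power).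
[cite: Balaban1985BackgroundPropagators, (3.133) p.422, Thm 3.12 p.423, (3.126) p.420, (3.42) p.397; Balaban1985Variational, (45)–(46) p.285, (103) p.293, (133) p.298] -/
theorem kernel133_family_of_kinvRow_of_piBlockLetters
    [hFL : ∀ F : T3Family, Fact (0 < (F.L : ℝ))] [hFη : ∀ (F : T3Family) (k : ℕ), Fact (0 < ((F.L : ℝ)⁻¹) ^ k)]
    (α : ℕ → ℝ) (hα : ∀ L : ℕ, 1 < L → 0 < α L) (hW : ∀ L : ℕ, 1 < L → 10 ^ 10 * (L : ℝ) ^ 6 * α L ≤ 1) (hW' : ∀ L : ℕ, 1 < L → 10 ^ 12 * (L : ℝ) ^ 3 * α L ≤ 1)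
    (c₀ cB : ℕ → ℝ) [hc₀ : ∀ L : ℕ, Fact (0 < c₀ L)] [hcB : ∀ L : ℕ, Fact (0 < cB L)] (a : ∀ L : ℕ, Idx L → ℝ) (ha : ∀ (L : ℕ) (i : Idx L), 0 ≤ a L i)
    (Λ : ∀ (L : ℕ) (i : Idx L), GaugeField (i.1.1.P i.1.2.2) 0 (Matrix.specialUnitaryGroup (Fin 2) ℂ) → Prop)
    (hposη : ∀ (L : ℕ), 1 < L → ∀ (i : Idx L) (U₀ : GaugeField (i.1.1.P i.1.2.2) 0 (Matrix.specialUnitaryGroup (Fin 2) ℂ)), ∀ ρ : ℝ, RegPr i.1.1 i.1.2.1 i.1.2.2 ρ U₀ → ρ ≤ α L →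
      Λ L i U₀ → PosOnto i.1.1 i.1.2.1 i.1.2.2 i.2.2.le (c₀ L) (cB L) (a L i) (DeltaEtaSlot i.1.1 i.1.2.1 i.1.2.2 (c₀ L)) U₀)
    (hpos : ∀ (L : ℕ), 1 < L → ∀ (i : Idx L) (U₀ : GaugeField (i.1.1.P i.1.2.2) 0 (Matrix.specialUnitaryGroup (Fin 2) ℂ)), ∀ ρ : ℝ, RegPr i.1.1 i.1.2.1 i.1.2.2 ρ U₀ → ρ ≤ α L →
      Λ L i U₀ → PosOnto i.1.1 i.1.2.1 i.1.2.2 i.2.2.le (c₀ L) (cB L) (a L i) (DeltaPiSlotP i.1.1 i.1.2.1 i.1.2.2 i.2.2.le (c₀ L) (cB L) (a L i)) U₀)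
    (CK δ : ℕ → ℝ) (hCK : ∀ L, 1 < L → 0 ≤ CK L) (hδ : ∀ L, 1 < L → 0 < δ L)
    (hKinv : ∀ (L : ℕ), 1 < L → ∀ (i : Idx L) (U₀ : GaugeField (i.1.1.P i.1.2.2) 0 (Matrix.specialUnitaryGroup (Fin 2) ℂ)), ∀ ρ : ℝ, RegPr i.1.1 i.1.2.1 i.1.2.2 ρ U₀ → ρ ≤ α L →
      Λ L i U₀ → ∀ (y : PBond (i.1.1.P i.1.2.1) 0) (Z : Matrix (Fin 2) (Fin 2) ℂ) (y' : PBond (i.1.1.P i.1.2.1) 0),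
        ‖(toL2B i.1.1 i.1.2.1 (cB L)).symm (KinvT i.1.1 i.1.2.1 i.1.2.2 i.2.2.le (c₀ L) (cB L) (a L i) (DeltaPiSlotP i.1.1 i.1.2.1 i.1.2.2 i.2.2.le (c₀ L) (cB L) (a L i)) U₀
            (toL2B i.1.1 i.1.2.1 (cB L) (Pi.single y Z))) y'‖
          ≤ CK L * ((c₀ L / cB L) * ((L : ℝ) ^ (i.1.2.2 - i.1.2.1)) ^ 3)
              * Real.exp (-(δ L * (Site.tdist (siteShift (sites_eq i.1.1 i.1.2.1 i.1.2.2 i.2.2.le) y'.src) (siteShift (sites_eq i.1.1 i.1.2.1 i.1.2.2 i.2.2.le) y.src) : ℝ))) * ‖Z‖)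
    (BV BD C₁ C₂ C₃ δ₁ ν : ℕ → ℝ) (hBV : ∀ L, 1 < L → 0 ≤ BV L) (hBD : ∀ L, 1 < L → 0 ≤ BD L) (hC₁ : ∀ L, 1 < L → 0 ≤ C₁ L) (hC₂ : ∀ L, 1 < L → 0 ≤ C₂ L)
    (hC₃ : ∀ L, 1 < L → 0 ≤ C₃ L) (hν : ∀ L, 1 < L → 0 < ν L) (hδ₁ : ∀ L, 1 < L → δ L + ν L ≤ δ₁ L)
    (hGb : ∀ (L : ℕ), 1 < L → ∀ (i : Idx L) (U₀ : GaugeField (i.1.1.P i.1.2.2) 0 (Matrix.specialUnitaryGroup (Fin 2) ℂ)), ∀ ρ : ℝ, RegPr i.1.1 i.1.2.1 i.1.2.2 ρ U₀ → ρ ≤ α L →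
      Λ L i U₀ → ∀ (X : PBond (i.1.1.P i.1.2.2) 0 → Matrix (Fin 2) (Fin 2) ℂ) (z : Site (i.1.1.P i.1.2.2) (i.1.2.2 - i.1.2.1)),
        (∀ b, X b ≠ 0 → iterBlockOf (i.1.2.2 - i.1.2.1) b.src = z) → ∀ s : ℝ, 0 ≤ s → (∀ b, ‖X b‖ ≤ s) →
          ∀ bd : PBond (i.1.1.P i.1.2.2) 0, ‖(toL2 i.1.1 i.1.2.2 (c₀ L)).symm (GT i.1.1 i.1.2.1 i.1.2.2 i.2.2.le (c₀ L) (cB L) (a L i)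
              (DeltaEtaSlot i.1.1 i.1.2.1 i.1.2.2 (c₀ L)) U₀ (toL2 i.1.1 i.1.2.2 (c₀ L) X)) bd‖
            ≤ s * BV L * Real.exp (-(δ₁ L * (Site.tdist (P := i.1.1.P i.1.2.2) (iterBlockOf (i.1.2.2 - i.1.2.1) bd.src) z : ℝ))))
    (hDb : ∀ (L : ℕ), 1 < L → ∀ (i : Idx L) (U₀ : GaugeField (i.1.1.P i.1.2.2) 0 (Matrix.specialUnitaryGroup (Fin 2) ℂ)), ∀ ρ : ℝ, RegPr i.1.1 i.1.2.1 i.1.2.2 ρ U₀ → ρ ≤ α L →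
      Λ L i U₀ → ∀ (X : PBond (i.1.1.P i.1.2.2) 0 → Matrix (Fin 2) (Fin 2) ℂ) (z : Site (i.1.1.P i.1.2.2) (i.1.2.2 - i.1.2.1)),
        (∀ b, X b ≠ 0 → iterBlockOf (i.1.2.2 - i.1.2.1) b.src = z) → ∀ s : ℝ, 0 ≤ s → (∀ b, ‖X b‖ ≤ s) →
          ∀ x : Site (i.1.1.P i.1.2.2) 0, ‖(toL2S i.1.1 i.1.2.2 (c₀ L)).symm (DstarL2 i.1.1 i.1.2.1 i.1.2.2 (c₀ L) U₀ (GT i.1.1 i.1.2.1 i.1.2.2 i.2.2.le (c₀ L) (cB L) (a L i)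
              (DeltaEtaSlot i.1.1 i.1.2.1 i.1.2.2 (c₀ L)) U₀ (toL2 i.1.1 i.1.2.2 (c₀ L) X))) x‖
            ≤ s * BD L * Real.exp (-(δ₁ L * (Site.tdist (P := i.1.1.P i.1.2.2) (iterBlockOf (i.1.2.2 - i.1.2.1) x) z : ℝ))))
    (hc1b : ∀ (L : ℕ), 1 < L → ∀ (i : Idx L) (U₀ : GaugeField (i.1.1.P i.1.2.2) 0 (Matrix.specialUnitaryGroup (Fin 2) ℂ)), ∀ ρ : ℝ, RegPr i.1.1 i.1.2.1 i.1.2.2 ρ U₀ → ρ ≤ α L →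
      Λ L i U₀ → ∀ (v : Site (i.1.1.P i.1.2.2) 0 → Matrix (Fin 2) (Fin 2) ℂ) (z : Site (i.1.1.P i.1.2.2) (i.1.2.2 - i.1.2.1)),
        (∀ y, v y ≠ 0 → iterBlockOf (i.1.2.2 - i.1.2.1) y = z) → ∀ m : ℝ, 0 ≤ m → (∀ y, ‖v y‖ ≤ m) →
          ∀ y : Site (i.1.1.P i.1.2.2) 0, ‖(toL2S i.1.1 i.1.2.2 (c₀ L)).symm (GprimeP i.1.1 i.1.2.1 i.1.2.2 i.2.2.le (c₀ L) (cB L) (a L i) U₀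
              (RS i.1.1 i.1.2.1 i.1.2.2 i.2.2.le (c₀ L) (cB L) U₀ (toL2S i.1.1 i.1.2.2 (c₀ L) v))) y‖
            ≤ m * C₁ L * Real.exp (-(δ₁ L * (Site.tdist (P := i.1.1.P i.1.2.2) (iterBlockOf (i.1.2.2 - i.1.2.1) y) z : ℝ))))
    (hc2b : ∀ (L : ℕ), 1 < L → ∀ (i : Idx L) (U₀ : GaugeField (i.1.1.P i.1.2.2) 0 (Matrix.specialUnitaryGroup (Fin 2) ℂ)), ∀ ρ : ℝ, RegPr i.1.1 i.1.2.1 i.1.2.2 ρ U₀ → ρ ≤ α L →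
      Λ L i U₀ → ∀ (v : Site (i.1.1.P i.1.2.2) 0 → Matrix (Fin 2) (Fin 2) ℂ) (z : Site (i.1.1.P i.1.2.2) (i.1.2.2 - i.1.2.1)),
        (∀ y, v y ≠ 0 → iterBlockOf (i.1.2.2 - i.1.2.1) y = z) → ∀ m : ℝ, 0 ≤ m → (∀ y, ‖v y‖ ≤ m) →
          ∀ b : PBond (i.1.1.P i.1.2.2) 0, ‖(toL2 i.1.1 i.1.2.2 (c₀ L)).symm (DL2 i.1.1 i.1.2.1 i.1.2.2 (c₀ L) U₀ (GprimeP i.1.1 i.1.2.1 i.1.2.2 i.2.2.le (c₀ L) (cB L) (a L i) U₀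
              (RS i.1.1 i.1.2.1 i.1.2.2 i.2.2.le (c₀ L) (cB L) U₀ (toL2S i.1.1 i.1.2.2 (c₀ L) v)))) b‖
            ≤ m * C₂ L * Real.exp (-(δ₁ L * (Site.tdist (P := i.1.1.P i.1.2.2) (iterBlockOf (i.1.2.2 - i.1.2.1) b.src) z : ℝ))))
    (hc3b : ∀ (L : ℕ), 1 < L → ∀ (i : Idx L) (U₀ : GaugeField (i.1.1.P i.1.2.2) 0 (Matrix.specialUnitaryGroup (Fin 2) ℂ)), ∀ ρ : ℝ, RegPr i.1.1 i.1.2.1 i.1.2.2 ρ U₀ → ρ ≤ α L →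
      Λ L i U₀ → ∀ (v : Site (i.1.1.P i.1.2.2) 0 → Matrix (Fin 2) (Fin 2) ℂ) (z : Site (i.1.1.P i.1.2.2) (i.1.2.2 - i.1.2.1)),
        (∀ y, v y ≠ 0 → iterBlockOf (i.1.2.2 - i.1.2.1) y = z) → ∀ m : ℝ, 0 ≤ m → (∀ y, ‖v y‖ ≤ m) →
          ∀ y : Site (i.1.1.P i.1.2.2) 0, ‖(toL2S i.1.1 i.1.2.2 (c₀ L)).symm (RS i.1.1 i.1.2.1 i.1.2.2 i.2.2.le (c₀ L) (cB L) U₀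
              (GprimeP i.1.1 i.1.2.1 i.1.2.2 i.2.2.le (c₀ L) (cB L) (a L i) U₀ (toL2S i.1.1 i.1.2.2 (c₀ L) v))) y‖
            ≤ m * C₃ L * Real.exp (-(δ₁ L * (Site.tdist (P := i.1.1.P i.1.2.2) (iterBlockOf (i.1.2.2 - i.1.2.1) y) z : ℝ))))
    (hwin : ∀ L, 1 < L → 2 * (1 + Real.exp (4 * δ L)) * (α L * (C₁ L * (2 * (1 + 1 / ν L)) ^ 3) * (BV L * (2 * (1 + 1 / ν L)) ^ 3 + BD L * (2 * (1 + 1 / ν L)) ^ 3)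
      + 3 * α L * (C₃ L * (2 * (1 + 1 / ν L)) ^ 3) * (1 + C₂ L * (2 * (1 + 1 / ν L)) ^ 3)
        * (1 + C₂ L * (2 * (1 + 1 / ν L)) ^ 3 + 2 * (1 + Real.exp (4 * δ L)) * α L * (C₁ L * (2 * (1 + 1 / ν L)) ^ 3)
          * (BV L * (2 * (1 + 1 / ν L)) ^ 3 + BD L * (2 * (1 + 1 / ν L)) ^ 3))) ≤ 1 / 2) :
    ∀ (L : ℕ), 1 < L → ∀ (i : Idx L) (U₀ : GaugeField (i.1.1.P i.1.2.2) 0 (Matrix.specialUnitaryGroup (Fin 2) ℂ)), ∀ ρ : ℝ, RegPr i.1.1 i.1.2.1 i.1.2.2 ρ U₀ → ρ ≤ α L →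
      Λ L i U₀ → ∀ (y : PBond (i.1.1.P i.1.2.1) 0) (Z : Matrix (Fin 2) (Fin 2) ℂ) (b' : Bond 3 (periodsT3 i.1.1 i.1.2.2)),
        ‖flat115 ((H1f i.1.1 i.1.2.1 i.1.2.2 i.2.2.le (c₀ L) (cB L) (a L i) (DeltaPiSlotP i.1.1 i.1.2.1 i.1.2.2 i.2.2.le (c₀ L) (cB L) (a L i)) U₀) (Pi.single y Z)) b'‖
          ≤ (1920 * Real.exp (δ L + 1) * CK L * (2 * (BV L * (2 * (1 + 1 / ν L)) ^ 3 + BD L * (2 * (1 + 1 / ν L)) ^ 3)) * (2 * (1 + 2 / δ L)) ^ 3)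
              * Real.exp (-(δ L / 2 * (Site.tdist (B5Eq118OneStroke.iterBlockOf (i.1.2.2 - i.1.2.1) ((bondEquiv i.1.1 i.1.2.2).symm b').src)
                  (T3LevelShift.siteShift (T3PrintedRegularOrbits.sites_eq i.1.1 i.1.2.1 i.1.2.2 i.2.2.le) y.src) : ℝ))) * ‖Z‖ :=
  kernel133_family_of_kinvRow_of_greenBlockSup α hα hW hW' c₀ cB a Λ hpos CK
    (fun L => 2 * (BV L * (2 * (1 + 1 / ν L)) ^ 3 + BD L * (2 * (1 + 1 / ν L)) ^ 3)) δ hCK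
    (fun L hL => by have := hBV L hL; have := hBD L hL; have := hν L hL; positivity) hδ hKinv
    (hGblk_pi_family_of_blockLetters α c₀ cB a ha Λ hposη hpos BV BD C₁ C₂ C₃ δ δ₁ ν hBV hBD hC₁ hC₂ hC₃ (fun L hL => (hδ L hL).le) hν hδ₁
      hGb hDb hc1b hc2b hc3b hwin)

end Family

end Summit.QuantumFields.YangMills.Theorems.Prop7Kernel133OfPiBlockLetters

end
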